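import Literature.Computability.MetaComplexity.ParityModTestCosetDensity
import Literature.Combinatorics.Optimization.PseudoBooleanMultilinear
import HarnessLib

/-!
# Sparse holomorphic character sums that are constant on a parity coset of the cube: the COVER LEMMA

**Sources.** D. A. Mix Barrington, H. Straubing, D. Thérien, *Non-uniform automata over groups*,
Inform. and Comput. 89 (1990) 109–132, §6 (pp. 123–125): the product functions
`Q_w(x) = ω^{w·x}` on `{0,1}ⁿ`, `w ∈ (ℤ/p)ⁿ`, their multiplicativity and the expansion of functions
computed by `MOD_q ∘ MOD_p` programs as combinations of the `Q_w` [BarringtonStraubingTherien1990];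
E. Boros, P. L. Hammer, *Pseudo-Boolean optimization*, Discrete Appl. Math. 123 (2002), §4.1
Proposition 2: uniqueness of the multilinear representation of a function on the cube (tree:
`Literature.Combinatorics.Optimization.PseudoBoolean.multilinear_injective`) [BorosHammer2002].

**What is proved (all proved, no named facts).**  Over a field `F` of characteristic `2`
containing `ω` with `ω² + ω + 1 = 0`, a HOLOMORPHIC sum is `R(u) = Σ_g a_g ω^{⟨w_g, u⟩}`
(`holoSum`; one character `cubeChar ω w_g` per row, exponent vectors `w_g ∈ (ℤ/3)^z`).  The merged
coefficient of a row `b` is `A(w_b) = Σ_{g : w_g = w_b} a_g` (`mergedCoeff`); row `g` COVERS row `b`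
if `#{i : w_{b,i} ≠ 0, w_{g,i} = 0} ≤ 2` (`Covers`).

* `holoCosetCover` — **COVER LEMMA**: if `z ≥ 3`, `w_b ≠ 0`, `A(w_b) ≠ 0` and `R` is constant on the
  parity coset `H_ε` (`ParityModTestDensity.parityCoset`), then some row `g` with `w_g ≠ w_b` and
  `A(w_g) ≠ 0` covers `b`.  `holoCosetCover_of_exists_zero` — the same without `z ≥ 3` when `w_b` has
  a zero coordinate (cover with `≤ 1` exception); `not_const_example` — at `z = 2` the single character
  `ω^{u₀+u₁}` IS constant on the odd coset, so `z ≥ 3` cannot be dropped in general.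
* Mechanism (multilinear normal form): on the point `𝟙_T` one has `ω^{⟨w,𝟙_T⟩} = ∏_{i∈T}(1 + δ_i)`,
  `δ_i = ω^{w_i} − 1` (`cubeChar_indVec`), so `R(𝟙_T) = Σ_{S ⊆ T} r_S` with `r_S = Σ_g a_g ∏_{i∈S} δ_{g,i}`
  (`holoSum_indVec_eq_sum_powerset`); the coset indicator is `c_ε + |T|` (`cosetInd_eq`); the product
  `(R − κ)·1_{H_ε} ≡ 0` has multilinear coefficients
  `C(V) = (c_ε + |V|) p_V + Σ_{i∈V} p_{V∖i}` (`sum_powerset_coverCoeff`), hence all `C(V) = 0`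
  (`coverCoeff_eq_zero`, by `multilinear_injective`); for `|V| ≥ 2`, `C(V) = Σ_g a_g τ_V(w_g)` with
  `τ_V(y) = (c_ε+|V|)π_y(V) + Σ_{i∈V} π_y(V∖i)` (`coverCoeff_eq_sum_tau`); `τ_V(y) ≠ 0` forces `y` to be
  non-zero on `V` minus one point (`card_filter_le_of_tau_ne_zero`); and `τ_V(w_b) ≠ 0` for
  `V = supp w_b ∪ {i₀}` (`tau_insert_supp`), or — full support, `z ≥ 3` — for `V = univ` or
  `V = univ ∖ {j}` (`tau_univ_or_erase`), because `(ω^k − 1)·ω^k = 1` for `k ≠ 0` (`delta_mul_chi`).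
  Grouping the rows by exponent vector (`sum_eq_mergedCoeff_add`) finishes.

These forms are not located in print and are supplied here (consumer: cell qa-qnc0, ROUND-34 §4.2,
target `P-38b` = `AffBells35.HoloCosetCover`, whose definitions `cubeChar/holoSum/mergedCoeff/Covers`
are repeated VERBATIM; the typed target needs the extra hypothesis `3 ≤ z`, see `not_const_example`).
-/

noncomputable section

namespace Literature.Computability.MetaComplexity

namespace HoloCoset

open Finset ParityModTestDensity Literature.Combinatorics.Optimization.PseudoBoolean

variable {F : Type*} [Field F] {z m : ℕ}

/-! ### 1. The objects (verbatim `exp35/Sketch35.lean` §2) -/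

/-- The cube product function ("holomorphic character") `Q_w(u) = ω^{⟨w,u⟩}`, `u ∈ {0,1}^z`.
[cite: BarringtonStraubingTherien1990, §6 (p. 124, the functions Q_w)] -/
def cubeChar (ω : F) (w : Fin z → ZMod 3) (u : Fin z → Bool) : F :=
  ω ^ (∑ i, if u i then w i else (0 : ZMod 3)).val

/-- A holomorphic sum: ONE character per row, `R(u) = Σ_g a_g Q_{w_g}(u)`.
[cite: BarringtonStraubingTherien1990, §6 (combinations of the Q_w)] -/
def holoSum (ω : F) (a : Fin m → F) (w : Fin m → Fin z → ZMod 3) (u : Fin z → Bool) : F :=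
  ∑ g, a g * cubeChar ω (w g) u

/-- The merged coefficient of the exponent vector of row `b`: `A(w_b) = Σ_{g : w_g = w_b} a_g`.
[cite: BarringtonStraubingTherien1990, §6 (collecting equal Q_w); supplied here] -/
def mergedCoeff (a : Fin m → F) (w : Fin m → Fin z → ZMod 3) (b : Fin m) : F :=
  ∑ g ∈ univ.filter (fun g => w g = w b), a g

/-- Row `g` COVERS row `b`: `g` is present at every coordinate where `b` is, up to `≤ 2` exceptions.
[cite: BarringtonStraubingTherien1990, §6; notion supplied here (qa-qnc0 ROUND-34 §4.2)] -/
def Covers (w : Fin m → Fin z → ZMod 3) (b g : Fin m) : Prop :=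
  (univ.filter fun i => w b i ≠ 0 ∧ w g i = 0).card ≤ 2

/-! ### 2. The cube root `ω` in characteristic 2 -/

section Omega

variable [CharP F 2] {ω : F}

/-- `ω³ = 1`. [folklore] -/
private theorem omega_pow_three (hω : ω ^ 2 + ω + 1 = 0) : ω ^ 3 = 1 := by
  have h2 : (2 : F) = 0 := CharTwo.two_eq_zero
  linear_combination (ω + 1) * hω - (ω ^ 2 + ω + 1) * h2

/-- `χ(k) = ω^k ≠ 1` for `k ≠ 0`, and `= 1` for `k = 0`. [folklore] -/
private theorem chi_eq_one_iff (hω : ω ^ 2 + ω + 1 = 0) (k : ZMod 3) : chi ω k = 1 ↔ k = 0 := by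
  have h2 : (2 : F) = 0 := CharTwo.two_eq_zero
  have hω0 : ω ≠ 0 := by intro h; rw [h] at hω; simp at hω
  constructor
  · intro h
    by_contra hk
    have hval : k.val = 1 ∨ k.val = 2 := by
      have := k.val_lt; have h0 : k.val ≠ 0 := fun h0 => hk ((ZMod.val_eq_zero k).1 h0); omega
    unfold chi at h
    rcases hval with hv | hv
    · rw [hv, pow_one] at h
      rw [h] at hω
      have : (3 : F) = 0 := by linear_combination hω
      have h1 : (1 : F) = 0 := by linear_combination this - h2
      exact one_ne_zero h1
    · rw [hv] at h
      -- ω² = 1 ⇒ ω + 1 + 1 = 0 ⇒ ω = 0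
      have : ω = 0 := by linear_combination hω - h - h2
      exact hω0 this
  · intro h; rw [h]; simp [chi]

/-- `δ(k) := χ(k) − 1` is non-zero iff `k ≠ 0`. [folklore] -/
private theorem chi_sub_one_ne_zero_iff (hω : ω ^ 2 + ω + 1 = 0) (k : ZMod 3) :
    chi ω k - 1 ≠ 0 ↔ k ≠ 0 := by
  rw [Ne, sub_eq_zero, chi_eq_one_iff hω]

/-- The inverse of `δ(k)` for `k ≠ 0` is `χ(k)` itself: `(ω^k − 1)·ω^k = 1`. [folklore] -/
private theorem delta_mul_chi (hω : ω ^ 2 + ω + 1 = 0) {k : ZMod 3} (hk : k ≠ 0) :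
    (chi ω k - 1) * chi ω k = 1 := by
  have h2 : (2 : F) = 0 := CharTwo.two_eq_zero
  have h3 := omega_pow_three hω
  have hval : k.val = 1 ∨ k.val = 2 := by
    have := k.val_lt; have h0 : k.val ≠ 0 := fun h0 => hk ((ZMod.val_eq_zero k).1 h0); omega
  unfold chi
  rcases hval with hv | hv
  · rw [hv, pow_one]
    linear_combination hω - ω * h2 - h2
  · rw [hv]
    have h4 : ω ^ 4 = ω := by rw [show (4 : ℕ) = 3 + 1 by norm_num, pow_add, h3, one_mul, pow_one]
    linear_combination h4 - hω + ω * h2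

/-- `1 + χ(k) ≠ 0` for `k ≠ 0`. [folklore] -/
private theorem one_add_chi_ne_zero (hω : ω ^ 2 + ω + 1 = 0) {k : ZMod 3} (hk : k ≠ 0) :
    1 + chi ω k ≠ 0 := by
  have h2 : (2 : F) = 0 := CharTwo.two_eq_zero
  intro h
  have : chi ω k - 1 = 0 := by linear_combination h - h2
  exact (chi_sub_one_ne_zero_iff hω k).2 hk this

/-- In characteristic `2` a natural number casts to its parity. [folklore] -/
private theorem natCast_eq_ite (n : ℕ) : (n : F) = if n % 2 = 1 then 1 else 0 := by
  have h2 : (2 : F) = 0 := CharTwo.two_eq_zero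
  conv_lhs => rw [← Nat.div_add_mod n 2]
  push_cast
  rw [h2]
  split_ifs with h
  · rw [h]; simp
  · have h' : n % 2 = 0 := by omega
    rw [h']; simp

end Omega

/-! ### 3. Points as supports; the character at `𝟙_T` as a product; the `δ`-expansion -/

/-- The indicator vector `𝟙_T ∈ {0,1}^z` of a set of coordinates. [cite: BorosHammer2002, §4.1 (the characteristic vectors 𝟙_S)] -/
def indVec (T : Finset (Fin z)) : Fin z → Bool := fun i => decide (i ∈ T)

/-- `support (𝟙_T) = T`. [cite: BorosHammer2002, §4.1] -/
theorem support_indVec (T : Finset (Fin z)) : support (indVec T) = T := by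
  ext i; simp [indVec]

/-- `𝟙_{support u} = u`. [cite: BorosHammer2002, §4.1] -/
theorem indVec_support (u : Fin z → Bool) : indVec (support u) = u := by
  funext i; simp [indVec]

/-- `δ_y(i) = χ(y_i) − 1`. [cite: BarringtonStraubingTherien1990, §6; bookkeeping supplied here] -/
def delta (ω : F) (y : Fin z → ZMod 3) (i : Fin z) : F := chi ω (y i) - 1

/-- `π_y(S) = ∏_{i∈S} δ_y(i)` — the multilinear coefficient of `Q_y` at `S`.
[cite: BarringtonStraubingTherien1990, §6; supplied here] -/
def piCoeff (ω : F) (y : Fin z → ZMod 3) (S : Finset (Fin z)) : F := ∏ i ∈ S, delta ω y i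

/-- **The character at an indicator vector is a product**: `Q_y(𝟙_T) = ∏_{i∈T} χ(y_i)`.
[cite: BarringtonStraubingTherien1990, §6 (Q_w(x) = ∏ ω^{w_i x_i})] -/
theorem cubeChar_indVec [CharP F 2] {ω : F} (hω : ω ^ 2 + ω + 1 = 0) (y : Fin z → ZMod 3)
    (T : Finset (Fin z)) : cubeChar ω y (indVec T) = ∏ i ∈ T, chi ω (y i) := by
  have h3 := omega_pow_three hω
  have h := chi_form h3 y 0 (indVec T)
  rw [sub_zero, neg_zero] at h
  unfold cubeChar
  change chi ω _ = _
  rw [h]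
  unfold chi
  rw [ZMod.val_zero, pow_zero, one_mul]
  unfold ProductSpan.prodFn
  rw [← Finset.prod_filter_mul_prod_filter_not univ (fun i => i ∈ T)]
  have h1 : ∏ i ∈ univ.filter (fun i => i ∉ T), (if indVec T i = true then ω ^ (y i).val else 1) = 1 :=
    prod_eq_one fun i hi => by
      have : i ∉ T := (mem_filter.1 hi).2
      simp [indVec, this]
  rw [h1, mul_one]
  have hf : univ.filter (fun i => i ∈ T) = T := by ext i; simp
  rw [hf]
  exact prod_congr rfl fun i hi => by simp [indVec, hi]

/-- **The `δ`-expansion**: `Q_y(𝟙_T) = Σ_{S ⊆ T} π_y(S)`.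
[cite: BarringtonStraubingTherien1990, §6; multilinear form supplied here] -/
theorem cubeChar_indVec_eq_sum_powerset [CharP F 2] {ω : F} (hω : ω ^ 2 + ω + 1 = 0)
    (y : Fin z → ZMod 3) (T : Finset (Fin z)) :
    cubeChar ω y (indVec T) = ∑ S ∈ T.powerset, piCoeff ω y S := by
  rw [cubeChar_indVec hω]
  have : ∏ i ∈ T, chi ω (y i) = ∏ i ∈ T, (1 + delta ω y i) :=
    prod_congr rfl fun i _ => by simp [delta]
  rw [this, Finset.prod_one_add]
  rfl

/-- The multilinear coefficients of `R`: `r_S = Σ_g a_g π_{w_g}(S)`.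
[cite: BarringtonStraubingTherien1990, §6; supplied here] -/
def rCoeff (ω : F) (a : Fin m → F) (w : Fin m → Fin z → ZMod 3) (S : Finset (Fin z)) : F :=
  ∑ g, a g * piCoeff ω (w g) S

/-- **`R(𝟙_T) = Σ_{S ⊆ T} r_S`.** [cite: BarringtonStraubingTherien1990, §6; supplied here] -/
theorem holoSum_indVec_eq_sum_powerset [CharP F 2] {ω : F} (hω : ω ^ 2 + ω + 1 = 0)
    (a : Fin m → F) (w : Fin m → Fin z → ZMod 3) (T : Finset (Fin z)) :
    holoSum ω a w (indVec T) = ∑ S ∈ T.powerset, rCoeff ω a w S := by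
  unfold holoSum rCoeff
  simp_rw [cubeChar_indVec_eq_sum_powerset hω, Finset.mul_sum]
  rw [Finset.sum_comm]

/-! ### 4. The coset indicator and the product `(R − κ)·1_{H_ε}` in multilinear form -/

/-- `c_ε = [ε = false]` (so that `1_{H_ε}(𝟙_T) = c_ε + |T|` in characteristic 2).
[cite: BarringtonStraubingTherien1990, §6; bookkeeping supplied here] -/
def cEps (ε : Bool) : F := if ε then 0 else 1

/-- **The coset indicator is affine in characteristic 2**: `[𝟙_T ∈ H_ε] = c_ε + |T|`.
[cite: BarringtonStraubingTherien1990, §6; supplied here] -/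
theorem cosetInd_eq [CharP F 2] (ε : Bool) (T : Finset (Fin z)) :
    (if indVec T ∈ parityCoset z ε then (1 : F) else 0) = cEps ε + (T.card : F) := by
  have hmem : indVec T ∈ parityCoset z ε ↔ decide (Odd T.card) = ε := by
    unfold parityCoset
    rw [mem_filter]
    have : (univ.filter fun i => indVec T i = true) = T := by ext i; simp [indVec]
    simp [this]
  rw [natCast_eq_ite T.card]
  unfold cEps
  by_cases hodd : Odd T.card
  · have h1 : T.card % 2 = 1 := Nat.odd_iff.1 hodd
    cases ε <;> simp [hmem, hodd, h1, CharTwo.add_self_eq_zero]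
  · have h0 : ¬ (T.card % 2 = 1) := fun h => hodd (Nat.odd_iff.2 h)
    cases ε <;> simp [hmem, hodd, h0]

/-- The coefficients of `R − κ`: `p_S = r_S − κ[S = ∅]`. [cite: BorosHammer2002, §4.1; supplied here] -/
def pCoeff (ω : F) (a : Fin m → F) (w : Fin m → Fin z → ZMod 3) (κ : F) (S : Finset (Fin z)) : F :=
  rCoeff ω a w S - if S = ∅ then κ else 0

/-- **The multilinear coefficients of `(R − κ)·1_{H_ε}`**: `C(V) = (c_ε + |V|) p_V + Σ_{i∈V} p_{V∖i}`.
[cite: BorosHammer2002, §4.1 Prop. 2; product bookkeeping supplied here] -/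
def coverCoeff (ω : F) (a : Fin m → F) (w : Fin m → Fin z → ZMod 3) (κ : F) (ε : Bool)
    (V : Finset (Fin z)) : F :=
  (cEps ε + (V.card : F)) * pCoeff ω a w κ V + ∑ i ∈ V, pCoeff ω a w κ (V.erase i)

/-- The combinatorial identity behind the product: `Σ_{V⊆T} Σ_{i∈V} p(V∖i) = Σ_{S⊆T} (|T|−|S|)·p(S)`.
[cite: BorosHammer2002, §4.1; supplied here] -/
private theorem sum_powerset_sum_erase (p : Finset (Fin z) → F) (T : Finset (Fin z)) :
    ∑ V ∈ T.powerset, ∑ i ∈ V, p (V.erase i) = ∑ S ∈ T.powerset, ((T.card - S.card : ℕ) : F) * p S := by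
  classical
  -- count pairs (V, i), i ∈ V ⊆ T, as pairs (S, i), S ⊆ T, i ∈ T \ S, via V = insert i S
  have h1 : ∑ V ∈ T.powerset, ∑ i ∈ V, p (V.erase i)
      = ∑ i ∈ T, ∑ V ∈ T.powerset.filter (fun V => i ∈ V), p (V.erase i) := by
    rw [Finset.sum_comm' (t' := T) (s' := fun i => T.powerset.filter (fun V => i ∈ V))]
    intro V i
    simp only [mem_powerset, mem_filter]
    constructor
    · rintro ⟨hV, hi⟩; exact ⟨⟨hV, hi⟩, hV hi⟩
    · rintro ⟨⟨hV, hi⟩, _⟩; exact ⟨hV, hi⟩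
  have h2 : ∀ i ∈ T, ∑ V ∈ T.powerset.filter (fun V => i ∈ V), p (V.erase i)
      = ∑ S ∈ (T.erase i).powerset, p S := by
    intro i hi
    refine Finset.sum_nbij' (fun V => V.erase i) (fun S => insert i S) ?_ ?_ ?_ ?_ ?_
    · intro V hV
      simp only [mem_filter, mem_powerset] at hV
      rw [mem_powerset]
      exact erase_subset_erase i hV.1
    · intro S hS
      rw [mem_powerset, Finset.subset_erase] at hS
      simp only [mem_filter, mem_powerset, mem_insert, true_or, and_true]
      exact insert_subset hi hS.1
    · intro V hV
      simp only [mem_filter, mem_powerset] at hV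
      exact insert_erase hV.2
    · intro S hS
      rw [mem_powerset, Finset.subset_erase] at hS
      exact erase_insert hS.2
    · intro V _; rfl
  have h3 : ∀ i ∈ T, ∑ S ∈ (T.erase i).powerset, p S
      = ∑ S ∈ T.powerset, (if i ∉ S then p S else 0) := by
    intro i hi
    rw [← Finset.sum_filter]
    refine sum_congr ?_ fun _ _ => rfl
    ext S
    simp only [mem_powerset, mem_filter, Finset.subset_erase]
  rw [h1, sum_congr rfl fun i hi => (h2 i hi).trans (h3 i hi), Finset.sum_comm]
  refine sum_congr rfl fun S hS => ?_
  rw [mem_powerset] at hS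
  rw [← Finset.sum_filter, sum_const, nsmul_eq_mul]
  congr 1
  have : T.filter (fun i => i ∉ S) = T \ S := by ext i; simp [mem_sdiff]
  rw [this, card_sdiff_of_subset hS]

/-- **`Σ_{V ⊆ T} C(V) = (R(𝟙_T) − κ)·(c_ε + |T|)`**, i.e. `C` are the multilinear coefficients of
`(R − κ)·1_{H_ε}`. [cite: BorosHammer2002, §4.1 Prop. 2 (eq. (12)); supplied here] -/
theorem sum_powerset_coverCoeff [CharP F 2] {ω : F} (hω : ω ^ 2 + ω + 1 = 0)
    (a : Fin m → F) (w : Fin m → Fin z → ZMod 3) (κ : F) (ε : Bool) (T : Finset (Fin z)) :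
    ∑ V ∈ T.powerset, coverCoeff ω a w κ ε V
      = (holoSum ω a w (indVec T) - κ) * (cEps ε + (T.card : F)) := by
  classical
  unfold coverCoeff
  rw [sum_add_distrib, sum_powerset_sum_erase, ← sum_add_distrib]
  have hp : ∑ S ∈ T.powerset, pCoeff ω a w κ S = holoSum ω a w (indVec T) - κ := by
    unfold pCoeff
    rw [sum_sub_distrib, holoSum_indVec_eq_sum_powerset hω, Finset.sum_ite_eq' T.powerset ∅ (fun _ => κ),
      if_pos (empty_mem_powerset T)]
  rw [← hp, Finset.sum_mul]
  refine sum_congr rfl fun S hS => ?_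
  rw [mem_powerset] at hS
  rw [Nat.cast_sub (card_le_card hS)]
  ring

/-- **Every multilinear coefficient of `(R − κ)·1_{H_ε}` vanishes** when `R ≡ κ` on `H_ε`.
[cite: BorosHammer2002, §4.1 Prop. 2 (uniqueness); supplied here] -/
theorem coverCoeff_eq_zero [CharP F 2] {ω : F} (hω : ω ^ 2 + ω + 1 = 0)
    (a : Fin m → F) (w : Fin m → Fin z → ZMod 3) {κ : F} {ε : Bool}
    (hconst : ∀ u ∈ parityCoset z ε, holoSum ω a w u = κ) (V : Finset (Fin z)) :
    coverCoeff ω a w κ ε V = 0 := by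
  classical
  have hml : ∀ T : Finset (Fin z), multilinear (coverCoeff ω a w κ ε) T = multilinear (fun _ => (0 : F)) T := by
    intro T
    rw [multilinear_eq_sum_powerset, multilinear_eq_sum_powerset, sum_powerset_coverCoeff hω,
      sum_const_zero]
    by_cases hT : indVec T ∈ parityCoset z ε
    · rw [hconst _ hT, sub_self, zero_mul]
    · have h0 : cEps ε + (T.card : F) = 0 := by rw [← cosetInd_eq ε T, if_neg hT]
      rw [h0, mul_zero]
  have := multilinear_injective hml
  exact congrFun this V

/-! ### 5. Reading the coefficient at `|V| ≥ 2`: the weights `τ_V(y)` -/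

/-- `τ_V(y) = (c_ε + |V|)·π_y(V) + Σ_{i∈V} π_y(V∖i)` — the contribution of ONE exponent vector to `C(V)`.
[cite: BarringtonStraubingTherien1990, §6; supplied here] -/
def tau (ω : F) (ε : Bool) (V : Finset (Fin z)) (y : Fin z → ZMod 3) : F :=
  (cEps ε + (V.card : F)) * piCoeff ω y V + ∑ i ∈ V, piCoeff ω y (V.erase i)

/-- For `|V| ≥ 2` the constant `κ` does not enter: `C(V) = Σ_g a_g τ_V(w_g)`.
[cite: BarringtonStraubingTherien1990, §6; supplied here] -/
theorem coverCoeff_eq_sum_tau (ω : F) (a : Fin m → F) (w : Fin m → Fin z → ZMod 3) (κ : F) (ε : Bool)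
    {V : Finset (Fin z)} (hV : 2 ≤ V.card) :
    coverCoeff ω a w κ ε V = ∑ g, a g * tau ω ε V (w g) := by
  have hVne : V ≠ ∅ := by rintro rfl; simp at hV
  have hVi : ∀ i ∈ V, V.erase i ≠ ∅ := fun i hi => by
    rw [← Finset.nonempty_iff_ne_empty, ← Finset.card_pos, card_erase_of_mem hi]; omega
  unfold coverCoeff pCoeff tau rCoeff
  rw [if_neg hVne, sub_zero]
  have hin : ∀ i ∈ V, (∑ g, a g * piCoeff ω (w g) (V.erase i)) - (if V.erase i = ∅ then κ else 0)
      = ∑ g, a g * piCoeff ω (w g) (V.erase i) := fun i hi => by rw [if_neg (hVi i hi), sub_zero]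
  rw [sum_congr rfl hin]
  symm
  calc ∑ g, a g * ((cEps ε + (V.card : F)) * piCoeff ω (w g) V + ∑ i ∈ V, piCoeff ω (w g) (V.erase i))
      = ∑ g, ((cEps ε + (V.card : F)) * (a g * piCoeff ω (w g) V)
          + ∑ i ∈ V, a g * piCoeff ω (w g) (V.erase i)) :=
        sum_congr rfl fun g _ => by rw [mul_add, Finset.mul_sum]; ring
    _ = (cEps ε + (V.card : F)) * ∑ g, a g * piCoeff ω (w g) V
          + ∑ i ∈ V, ∑ g, a g * piCoeff ω (w g) (V.erase i) := by
        rw [sum_add_distrib, ← Finset.mul_sum, Finset.sum_comm]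

/-- `π_y(S) ≠ 0` iff `y` has no zero coordinate on `S`. [cite: BarringtonStraubingTherien1990, §6; supplied here] -/
theorem piCoeff_ne_zero_iff [CharP F 2] {ω : F} (hω : ω ^ 2 + ω + 1 = 0) (y : Fin z → ZMod 3)
    (S : Finset (Fin z)) : piCoeff ω y S ≠ 0 ↔ ∀ i ∈ S, y i ≠ 0 := by
  unfold piCoeff
  rw [Finset.prod_ne_zero_iff]
  exact forall₂_congr fun i _ => chi_sub_one_ne_zero_iff hω (y i)

/-- **A non-zero weight forces a near-cover**: if `τ_V(y) ≠ 0` then `y` is non-zero on all of `V` but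
at most one point, so `#{j : w_{b,j} ≠ 0, y_j = 0} ≤ #{j ∉ V : w_{b,j} ≠ 0} + 1`.
[cite: BarringtonStraubingTherien1990, §6; supplied here] -/
theorem card_filter_le_of_tau_ne_zero [CharP F 2] {ω : F} (hω : ω ^ 2 + ω + 1 = 0) {ε : Bool}
    {V : Finset (Fin z)} {y : Fin z → ZMod 3} (h : tau ω ε V y ≠ 0) (wb : Fin z → ZMod 3) :
    (univ.filter fun j => wb j ≠ 0 ∧ y j = 0).card
      ≤ (univ.filter fun j => wb j ≠ 0 ∧ j ∉ V).card + 1 := by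
  classical
  -- some S ∈ {V} ∪ {V.erase i} has π_y(S) ≠ 0
  obtain ⟨S, hSV, hScard, hS⟩ : ∃ S, S ⊆ V ∧ V.card ≤ S.card + 1 ∧ piCoeff ω y S ≠ 0 := by
    unfold tau at h
    by_cases h1 : piCoeff ω y V ≠ 0
    · exact ⟨V, Subset.rfl, by omega, h1⟩
    · push Not at h1
      rw [h1, mul_zero, zero_add] at h
      obtain ⟨i, hi, hne⟩ := Finset.exists_ne_zero_of_sum_ne_zero h
      exact ⟨V.erase i, erase_subset _ _, by rw [card_erase_of_mem hi]; omega, hne⟩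
  rw [piCoeff_ne_zero_iff hω] at hS
  -- the zeros of y inside supp wb lie outside S, hence in (supp wb \ V) ∪ (V \ S)
  calc (univ.filter fun j => wb j ≠ 0 ∧ y j = 0).card
      ≤ ((univ.filter fun j => wb j ≠ 0 ∧ j ∉ V) ∪ (V \ S)).card := by
        refine card_le_card fun j hj => ?_
        simp only [mem_filter, mem_univ, true_and] at hj
        rw [mem_union, mem_filter, mem_sdiff]
        by_cases hjV : j ∈ V
        · right; exact ⟨hjV, fun hjS => hS j hjS hj.2⟩
        · left; exact ⟨mem_univ _, hj.1, hjV⟩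
    _ ≤ (univ.filter fun j => wb j ≠ 0 ∧ j ∉ V).card + (V \ S).card := card_union_le _ _
    _ ≤ (univ.filter fun j => wb j ≠ 0 ∧ j ∉ V).card + 1 := by
        have : (V \ S).card = V.card - S.card := card_sdiff_of_subset hSV
        omega

/-! ### 6. The weight of `b` itself is non-zero for a suitable `V` -/

/-- **Case A** (`w_b` has a zero coordinate `i₀`): with `V = supp(w_b) ∪ {i₀}`,
`τ_V(w_b) = π_{w_b}(supp w_b) ≠ 0`. [cite: BarringtonStraubingTherien1990, §6; supplied here] -/
theorem tau_insert_supp [CharP F 2] {ω : F} (hω : ω ^ 2 + ω + 1 = 0) (ε : Bool)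
    (y : Fin z → ZMod 3) {i₀ : Fin z} (hi₀ : y i₀ = 0) :
    tau ω ε (insert i₀ (univ.filter fun i => y i ≠ 0)) y ≠ 0 := by
  classical
  set Sb := univ.filter fun i => y i ≠ 0 with hSb
  have hi₀S : i₀ ∉ Sb := by simp [hSb, hi₀]
  have hδ0 : delta ω y i₀ = 0 := by simp [delta, hi₀, chi]
  have hπ0 : ∀ S, i₀ ∈ S → piCoeff ω y S = 0 := fun S hS => prod_eq_zero hS hδ0
  have hmain : tau ω ε (insert i₀ Sb) y = piCoeff ω y Sb := by
    unfold tau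
    rw [hπ0 _ (mem_insert_self _ _), mul_zero, zero_add, sum_insert hi₀S, erase_insert hi₀S]
    rw [sum_eq_zero fun i hi => hπ0 _ ?_, add_zero]
    rw [mem_erase]
    exact ⟨fun h => hi₀S (h ▸ hi), mem_insert_self _ _⟩
  rw [hmain, piCoeff_ne_zero_iff hω]
  intro i hi
  exact (mem_filter.1 hi).2

/-- If `y` has no zero on `V` then `τ_V(y) = π_y(V)·(c_ε + |V| + Σ_{i∈V} χ(y_i))`
(because `π_y(V∖i) = π_y(V)·χ(y_i)`, `χ(y_i)` being the inverse of `δ_i`).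
[cite: BarringtonStraubingTherien1990, §6; supplied here] -/
theorem tau_eq_of_forall_ne_zero [CharP F 2] {ω : F} (hω : ω ^ 2 + ω + 1 = 0) (ε : Bool)
    {V : Finset (Fin z)} {y : Fin z → ZMod 3} (hy : ∀ i ∈ V, y i ≠ 0) :
    tau ω ε V y = piCoeff ω y V * (cEps ε + (V.card : F) + ∑ i ∈ V, chi ω (y i)) := by
  classical
  have herase : ∀ i ∈ V, piCoeff ω y (V.erase i) = piCoeff ω y V * chi ω (y i) := by
    intro i hi
    unfold piCoeff
    rw [← Finset.mul_prod_erase V (delta ω y) hi, mul_comm (delta ω y i), mul_assoc]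
    unfold delta
    rw [delta_mul_chi hω (hy i hi), mul_one]
  unfold tau
  rw [sum_congr rfl herase, ← Finset.mul_sum]
  ring

/-- **Case B** (`w_b` has full support, `z ≥ 3`): `τ_V(w_b) ≠ 0` for `V = univ` or for some
`V = univ ∖ {j}`. [cite: BarringtonStraubingTherien1990, §6; supplied here] -/
theorem tau_univ_or_erase [CharP F 2] {ω : F} (hω : ω ^ 2 + ω + 1 = 0) (ε : Bool) (hz : 3 ≤ z)
    {y : Fin z → ZMod 3} (hy : ∀ i, y i ≠ 0) :
    tau ω ε univ y ≠ 0 ∨ ∃ j : Fin z, tau ω ε (univ.erase j) y ≠ 0 := by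
  classical
  have h2 : (2 : F) = 0 := CharTwo.two_eq_zero
  have hπu : piCoeff ω y univ ≠ 0 := (piCoeff_ne_zero_iff hω y univ).2 fun i _ => hy i
  by_cases hB : cEps ε + ((univ : Finset (Fin z)).card : F) + ∑ i, chi ω (y i) = 0
  · right
    have hz0 : 0 < z := by omega
    let j : Fin z := ⟨0, hz0⟩
    refine ⟨j, ?_⟩
    have hπ : piCoeff ω y (univ.erase j) ≠ 0 :=
      (piCoeff_ne_zero_iff hω y _).2 fun i _ => hy i
    rw [tau_eq_of_forall_ne_zero hω ε (fun i _ => hy i)]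
    refine mul_ne_zero hπ ?_
    -- bracket(univ ∖ j) = bracket(univ) − 1 − χ(y_j) = −(1 + χ(y_j)) ≠ 0
    have hsum : ∑ i ∈ univ.erase j, chi ω (y i) = ∑ i, chi ω (y i) - chi ω (y j) := by
      rw [← Finset.sum_erase_add univ _ (mem_univ j)]; ring
    have hcard : ((univ.erase j).card : F) = ((univ : Finset (Fin z)).card : F) - 1 := by
      rw [card_erase_of_mem (mem_univ j), Nat.cast_sub (by rw [card_univ, Fintype.card_fin]; omega),
        Nat.cast_one]
    rw [hsum, hcard]
    have hne := one_add_chi_ne_zero hω (hy j)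
    intro h0
    apply hne
    linear_combination hB - h0
  · left
    rw [tau_eq_of_forall_ne_zero hω ε (fun i _ => hy i)]
    exact mul_ne_zero hπu hB

/-! ### 7. Grouping rows by exponent vector; the cover lemma -/

/-- Grouping the rows by exponent vector: `Σ_g a_g τ(w_g) = A(w_b)·τ(w_b) + Σ_{g : w_g ≠ w_b} a_g τ(w_g)`,
and the second sum vanishes if every class `w' ≠ w_b` has `A(w') = 0` or `τ(w') = 0`.
[cite: BarringtonStraubingTherien1990, §6 (collecting equal characters); supplied here] -/
theorem sum_eq_mergedCoeff_mul (a : Fin m → F) (w : Fin m → Fin z → ZMod 3) (b : Fin m) (t : (Fin z → ZMod 3) → F)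
    (h : ∀ g, w g ≠ w b → mergedCoeff a w g = 0 ∨ t (w g) = 0) :
    ∑ g, a g * t (w g) = mergedCoeff a w b * t (w b) := by
  classical
  rw [← Finset.sum_filter_add_sum_filter_not univ (fun g => w g = w b)]
  have h1 : ∑ g ∈ univ.filter (fun g => w g = w b), a g * t (w g) = mergedCoeff a w b * t (w b) := by
    unfold mergedCoeff
    rw [Finset.sum_mul]
    exact sum_congr rfl fun g hg => by rw [(mem_filter.1 hg).2]
  have h2 : ∑ g ∈ univ.filter (fun g => ¬ w g = w b), a g * t (w g) = 0 := by
    -- fiberwise over the exponent vectors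
    rw [← Finset.sum_fiberwise_of_maps_to (g := w) (t := univ.image w) (fun g _ => mem_image_of_mem w (mem_univ g))]
    refine sum_eq_zero fun y _ => ?_
    by_cases hyb : y = w b
    · refine sum_eq_zero fun g hg => ?_
      simp only [mem_filter] at hg
      exact absurd (hg.2.trans hyb) hg.1.2
    · -- the fibre {g : w g ≠ w b, w g = y} = {g : w g = y}; its a-sum is the merged coefficient of the class
      have hfib : (univ.filter (fun g => ¬ w g = w b)).filter (fun g => w g = y) = univ.filter (fun g => w g = y) := by
        ext g; simp only [mem_filter, mem_univ, true_and]
        constructor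
        · exact fun h => h.2
        · intro hg; exact ⟨fun h' => hyb (hg ▸ h'), hg⟩
      rw [hfib]
      have hrew : ∑ g ∈ univ.filter (fun g => w g = y), a g * t (w g) = (∑ g ∈ univ.filter (fun g => w g = y), a g) * t y := by
        rw [Finset.sum_mul]; exact sum_congr rfl fun g hg => by rw [(mem_filter.1 hg).2]
      rw [hrew]
      by_cases hempty : univ.filter (fun g => w g = y) = ∅
      · rw [hempty, sum_empty, zero_mul]
      · obtain ⟨g₀, hg₀⟩ := nonempty_iff_ne_empty.2 hempty
        have hwg₀ : w g₀ = y := (mem_filter.1 hg₀).2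
        have hcl : univ.filter (fun g => w g = y) = univ.filter (fun g => w g = w g₀) := by rw [hwg₀]
        rcases h g₀ (hwg₀ ▸ hyb) with h0 | h0
        · unfold mergedCoeff at h0
          rw [hcl, h0, zero_mul]
        · rw [hwg₀] at h0; rw [h0, mul_zero]
  rw [h1, h2, add_zero]

/-- The core step: from `C(V) = 0`, `|V| ≥ 2`, `τ_V(w_b) ≠ 0`, `A(w_b) ≠ 0` and the a-priori bound
`#{j ∉ V : w_{b,j} ≠ 0} + 1 ≤ 2`, a covering row with a different exponent vector exists.
[cite: BarringtonStraubingTherien1990, §6; supplied here] -/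
theorem exists_cover_of_tau_ne_zero [CharP F 2] {ω : F} (hω : ω ^ 2 + ω + 1 = 0)
    (a : Fin m → F) (w : Fin m → Fin z → ZMod 3) {κ : F} {ε : Bool} (b : Fin m)
    (hconst : ∀ u ∈ parityCoset z ε, holoSum ω a w u = κ) (hA : mergedCoeff a w b ≠ 0)
    {V : Finset (Fin z)} (hV : 2 ≤ V.card) (hτ : tau ω ε V (w b) ≠ 0)
    (hout : (univ.filter fun j => w b j ≠ 0 ∧ j ∉ V).card + 1 ≤ 2) :
    ∃ g : Fin m, w g ≠ w b ∧ mergedCoeff a w g ≠ 0 ∧ Covers w b g := by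
  classical
  by_contra hno
  push Not at hno
  have hC := coverCoeff_eq_zero hω a w hconst V
  rw [coverCoeff_eq_sum_tau ω a w κ ε hV] at hC
  rw [sum_eq_mergedCoeff_mul a w b (tau ω ε V) ?_] at hC
  · exact mul_ne_zero hA hτ hC
  · intro g hg
    by_cases hAg : mergedCoeff a w g = 0
    · exact Or.inl hAg
    · right
      by_contra hτg
      have hcov : Covers w b g := by
        unfold Covers
        exact (card_filter_le_of_tau_ne_zero hω hτg (w b)).trans hout
      exact hno g hg hAg hcov

/-- **COVER LEMMA, case A** (no `z ≥ 3` needed): if `w_b` has a zero coordinate, `A(w_b) ≠ 0` and `R` is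
constant on `H_ε`, some row with a different exponent vector and non-zero merged coefficient covers `b`
(indeed with at most ONE exception). [cite: BarringtonStraubingTherien1990, §6; cover form supplied here] -/
theorem holoCosetCover_of_exists_zero [CharP F 2] {ω : F} (hω : ω ^ 2 + ω + 1 = 0)
    (a : Fin m → F) (w : Fin m → Fin z → ZMod 3) (ε : Bool) (b : Fin m)
    (hb : w b ≠ 0) (hzero : ∃ i₀, w b i₀ = 0) (hA : mergedCoeff a w b ≠ 0)
    (hconst : ∃ κ : F, ∀ u ∈ parityCoset z ε, holoSum ω a w u = κ) :
    ∃ g : Fin m, w g ≠ w b ∧ mergedCoeff a w g ≠ 0 ∧ Covers w b g := by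
  classical
  obtain ⟨κ, hκ⟩ := hconst
  obtain ⟨i₀, hi₀⟩ := hzero
  set Sb := univ.filter fun i => w b i ≠ 0 with hSb
  have hSbne : Sb.Nonempty := by
    by_contra h
    rw [not_nonempty_iff_eq_empty] at h
    apply hb
    funext i
    rw [Pi.zero_apply]
    by_contra hi
    have : i ∈ Sb := by simp [hSb, hi]
    rw [h] at this
    exact absurd this (notMem_empty i)
  have hi₀S : i₀ ∉ Sb := by simp [hSb, hi₀]
  refine exists_cover_of_tau_ne_zero hω a w b hκ hA (V := insert i₀ Sb) ?_ (tau_insert_supp hω ε (w b) hi₀) ?_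
  · rw [card_insert_of_notMem hi₀S]
    have := hSbne.card_pos
    omega
  · have : univ.filter (fun j => w b j ≠ 0 ∧ j ∉ insert i₀ Sb) = ∅ := by
      ext j
      simp only [mem_filter, mem_univ, true_and, mem_insert, hSb, notMem_empty, iff_false, not_and, not_not]
      intro hj
      exact Or.inr hj
    rw [this, card_empty]
    omega

/-- **COVER LEMMA (`P-38b`)**: over a field of characteristic `2` with `ω² + ω + 1 = 0`, for `z ≥ 3`:
if the holomorphic sum `R = Σ_g a_g Q_{w_g}` is constant on the parity coset `H_ε` of `{0,1}^z`,
`w_b ≠ 0` and the merged coefficient of `w_b` is non-zero, then some row `g` with `w_g ≠ w_b` and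
non-zero merged coefficient covers `b` (`#{i : w_{b,i} ≠ 0, w_{g,i} = 0} ≤ 2`).
[cite: BarringtonStraubingTherien1990, §6 (product functions Q_w); BorosHammer2002, Prop. 2 (multilinear uniqueness); cover form supplied here] -/
theorem holoCosetCover (F : Type*) [Field F] [CharP F 2] (ω : F) (hω : ω ^ 2 + ω + 1 = 0)
    (z m : ℕ) (hz : 3 ≤ z) (a : Fin m → F) (w : Fin m → Fin z → ZMod 3) (ε : Bool) (b : Fin m)
    (hb : w b ≠ 0) (hA : mergedCoeff a w b ≠ 0)
    (hconst : ∃ κ : F, ∀ u ∈ parityCoset z ε, holoSum ω a w u = κ) :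
    ∃ g : Fin m, w g ≠ w b ∧ mergedCoeff a w g ≠ 0 ∧ Covers w b g := by
  classical
  by_cases hzero : ∃ i₀, w b i₀ = 0
  · exact holoCosetCover_of_exists_zero hω a w ε b hb hzero hA hconst
  · push Not at hzero
    obtain ⟨κ, hκ⟩ := hconst
    have hcardu : ((univ : Finset (Fin z)).card) = z := by rw [card_univ, Fintype.card_fin]
    rcases tau_univ_or_erase hω ε hz hzero with hτ | ⟨j, hτ⟩
    · refine exists_cover_of_tau_ne_zero hω a w b hκ hA (V := univ) (by rw [hcardu]; omega) hτ ?_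
      have : univ.filter (fun j => w b j ≠ 0 ∧ j ∉ (univ : Finset (Fin z))) = ∅ := by
        ext j; simp
      rw [this, card_empty]
      omega
    · refine exists_cover_of_tau_ne_zero hω a w b hκ hA (V := univ.erase j) ?_ hτ ?_
      · rw [card_erase_of_mem (mem_univ j), hcardu]; omega
      · have : univ.filter (fun i => w b i ≠ 0 ∧ i ∉ univ.erase j) ⊆ {j} := by
          intro i hi
          simp only [mem_filter, mem_univ, true_and, mem_erase, not_and, ne_eq] at hi
          rw [mem_singleton]
          by_contra hij
          exact absurd (hi.2 hij) (by simp)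
        have := card_le_card this
        rw [card_singleton] at this
        omega

/-! ### 8. Sharpness: `z ≥ 3` cannot be dropped -/

/-- **At `z = 2` a single character is constant on the odd coset**: `Q_{(1,1)}(10) = Q_{(1,1)}(01) = ω`,
so the hypothesis `3 ≤ z` (or a zero coordinate of `w_b`) in the cover lemma is necessary.
[cite: BarringtonStraubingTherien1990, §6; example supplied here] -/
theorem cubeChar_const_on_odd_coset_two (ω : F) :
    ∀ u ∈ parityCoset 2 true, cubeChar ω (fun _ : Fin 2 => (1 : ZMod 3)) u = ω := by
  intro u hu
  unfold parityCoset at hu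
  rw [mem_filter] at hu
  unfold cubeChar
  -- the two points of the odd coset
  have hcard : ((univ : Finset (Fin 2)).filter fun i => u i = true).card
      = (if u 0 = true then 1 else 0) + (if u 1 = true then 1 else 0) := by
    rw [Finset.card_filter, Fin.sum_univ_two]
  rw [hcard] at hu
  rw [Fin.sum_univ_two]
  have key : ((if u 0 then (1 : ZMod 3) else 0) + (if u 1 then (1 : ZMod 3) else 0)).val = 1 := by
    rcases h0 : u 0 with _ | _ <;> rcases h1 : u 1 with _ | _ <;>
      simp only [h0, h1, Bool.false_eq_true, ↓reduceIte, add_zero, zero_add, mem_univ, true_and] at hu ⊢ <;>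
      first | rfl | (exfalso; revert hu; decide)
  rw [key, pow_one]

end HoloCoset

end Literature.Computability.MetaComplexity
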